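import Summits.CriticalPhenomena.PercolationContinuityZ3.Theorems.PercNearOneGluingNoHeavyLowerTailSunflowerSafeFactor
import Summits.CriticalPhenomena.PercolationContinuityZ3.Theorems.PercNearOneGluingNoHeavyLowerTailSunflowerWindowKit
import HarnessLib
import HarnessLib.Audit

/-!
# `NoHeavyLowerTail` (crux stmt-CriticalPhenomena-4575), abstract sunflower cubic: THE PARTITION LEMMA ★ IS CLOSED UNDER DISJOINT UNION
# (`0 ≤ F.ZH → 0 ≤ G.ZH → 0 ≤ (F.join G).ZH`), by an explicit finite tensor certificate

Support file (seat `prim-ineq-gen-2` gen 27; `--supports stmt-CriticalPhenomena-4575`; sequel of `…SunflowerSafeFactor`).  No `sorry`, no named facts.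
Memo: run/shared/lean/prim/prim-ineq-gen-2/SAFE-FACTOR-GEN27.md §3.

THEOREM (`Sunflower.ZH_join_nonneg`).  For sunflowers `F` on `α` and `G` on `β` (monotone maps `2^α → M₃`, `2^β → M₃`): if `0 ≤ F.ZH` and `0 ≤ G.ZH`
then `0 ≤ (F.join G).ZH`, where `F.join G` is the θ-join on `α ⊕ β` (`lab S = lab_F (S ∩ α) ∨ lab_G (S ∩ β)`; the disjoint union of coloured
hypergraphs).  Hence ★ (`PartitionLemmaH`) holds for a sunflower iff it holds for each of its connected components: the "product theorem" asked for
in GRAPHMARK-LEAN-GEN26 §7 — NO side information beyond ★ of the factors is needed (the spectator-Gladkov rows used below are theorems for every sunflower).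

PROOF.  With `ℓ₁, ℓ₂` the label triples of ordered 3-partitions of `α`, `β`:
  `6 · (F.join G).ZH = Σ_{π₂} Σ_{π₁} S6join (ℓ₁; ℓ₂)`,  `S6join (u; c) = Σ_{ρ ∈ S₃} s6H (u ∨ ρc)`   (`Sunflower.six_mul_ZH_join`, block relabelling on the
`G` side), and the POINTWISE CERTIFICATE (`cert5`, from `certM` on the enumeration `M3` by `decide`): for all `u, c ∈ M₃³`,
  `2 · S6join (u; c) ≥ 6·R₀(u)·R₀(c) + Σ_k E_k(u)·row_k(c) + Σ_k E_k(c)·row_k(u)`,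
with rows `row = (s6H, R₀, R₁, R₂, R₃, R₄)` (`Rrow x` = symmetrised spectator-Gladkov row of the label `x`) and NONNEGATIVE integer weights `E_k` that
depend only on the multiset of the triple (`EHM`, `ER0M`, `ERpM`, `ER4M`; found by an exact LP over the 35 × 35 orbit pairs, memo §3).  Summing,
  `12 · (F.join G).ZH ≥ 6·Glad₀(F)·Glad₀(G) + Σ_k E_k(F)·Row_k(G) + Σ_k E_k(G)·Row_k(F) ≥ 0`,
because `Row_0 = ZH ≥ 0` by hypothesis and `Row_x = Σ_partitions Rrow x ≥ 0` (`sum_Rrow_nonneg`) for every sunflower.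
COROLLARY (memo §2): the safe-factor property `IsSafeWith` of `…SunflowerSafeFactor` is EQUIVALENT to ★ (the dual cone of
`cone(s6H, R₀..R₄, δ)` has 36 extreme rays, each certified by Gladkov rows plus, for the rays `(0,0,0)` and `(0,0,i)`, ★ itself).
-/

namespace Summit.CriticalPhenomena.PercolationContinuityZ3.Theorems.SunflowerPartition

open Finset

/-! ## The certificate on the enumeration `M3` -/

/-- Number of occurrences of `v` in the triple `(x,y,z)`. [this work] -/
def cntM (v x y z : M3) : ℕ := (if x = v then 1 else 0) + (if y = v then 1 else 0) + (if z = v then 1 else 0)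

/-- Some petal occurs exactly twice in the triple. [this work] -/
def dblM (x y z : M3) : Bool := (cntM .c1 x y z == 2) || (cntM .c2 x y z == 2) || (cntM .c3 x y z == 2)

/-- Certificate weight of the ★-row `s6H` (12 × the LP value; a function of the multiset of the triple). [this work] -/
def EHM (x y z : M3) : ℤ :=
  let a := cntM .b x y z
  let t := cntM .t x y z
  if a = 3 then 12
  else if a = 2 ∧ t = 0 then 4
  else if a = 1 ∧ t = 0 ∧ dblM x y z = true then 0
  else if a = 1 ∧ t = 0 then 4
  else if a = 1 ∧ t = 2 then 2
  else if a = 0 ∧ t = 0 ∧ dblM x y z = true then 4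
  else if a = 0 ∧ t = 0 ∧ cntM .c1 x y z = 1 ∧ cntM .c2 x y z = 1 ∧ cntM .c3 x y z = 1 then 1
  else if a = 0 ∧ t = 1 ∧ dblM x y z = false then 1
  else 0

/-- Certificate weight of the bottom-spectator Gladkov row (rainbow triples only). [this work] -/
def ER0M (x y z : M3) : ℤ :=
  if cntM .c1 x y z = 1 ∧ cntM .c2 x y z = 1 ∧ cntM .c3 x y z = 1 then 1 else 0

/-- Certificate weight of the petal-`i`-spectator Gladkov row. [this work] -/
def ERpM (i x y z : M3) : ℤ :=
  let a := cntM .b x y z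
  let t := cntM .t x y z
  let p := cntM i x y z
  if a = 2 ∧ t = 0 ∧ p = 0 then 4
  else if a = 2 ∧ t = 1 then 8
  else if a = 1 ∧ t = 0 ∧ p = 0 ∧ dblM x y z = true then 4
  else if a = 1 ∧ t = 1 ∧ p = 1 then 2
  else if a = 1 ∧ t = 1 ∧ p = 0 then 3
  else if a = 1 ∧ t = 2 then 4
  else if a = 0 ∧ t = 0 ∧ p = 1 ∧ dblM x y z = true then 2
  else 0

/-- Certificate weight of the top-spectator Gladkov row. [this work] -/
def ER4M (x y z : M3) : ℤ :=
  let a := cntM .b x y z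
  let t := cntM .t x y z
  if a = 2 ∧ t = 0 then 4
  else if a = 2 ∧ t = 1 then 6
  else if a = 1 ∧ t = 0 ∧ dblM x y z = true then 4
  else if a = 1 ∧ t = 0 then 1
  else if a = 1 ∧ t = 1 then 2
  else 0

/-- The symmetrised spectator-Gladkov row on the enumeration. [this work] -/
def RrowM (v x y z : M3) : ℤ :=
  (if x = v then kkM y z else 0) + (if y = v then kkM x z else 0) + (if z = v then kkM x y else 0)

/-- `Σ_{ρ ∈ S₃} s6H (u ∨ ρ c)` on the enumeration. [this work] -/
def S6joinM (x y z p q r : M3) : ℤ :=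
  s6HM (joinMM x p) (joinMM y q) (joinMM z r) + s6HM (joinMM x p) (joinMM y r) (joinMM z q)
    + s6HM (joinMM x q) (joinMM y p) (joinMM z r) + s6HM (joinMM x q) (joinMM y r) (joinMM z p)
    + s6HM (joinMM x r) (joinMM y p) (joinMM z q) + s6HM (joinMM x r) (joinMM y q) (joinMM z p)

/-- One half of the certificate: the weights of `(x,y,z)` against the rows of `(p,q,r)`. [this work] -/
def PM (x y z p q r : M3) : ℤ :=
  EHM x y z * s6HM p q r + ER0M x y z * RrowM .b p q r + ERpM .c1 x y z * RrowM .c1 p q r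
    + ERpM .c2 x y z * RrowM .c2 p q r + ERpM .c3 x y z * RrowM .c3 p q r + ER4M x y z * RrowM .t p q r

/-- The certificate's right-hand side. [this work] -/
def RHSM (x y z p q r : M3) : ℤ := 6 * RrowM .b x y z * RrowM .b p q r + PM x y z p q r + PM p q r x y z

/-- Certificate, first entry `⊥`. [this work] -/
theorem certM_b : ∀ y z p q r : M3, RHSM .b y z p q r ≤ 2 * S6joinM .b y z p q r := by decide +kernel
/-- Certificate, first entry petal 1. [this work] -/
theorem certM_c1 : ∀ y z p q r : M3, RHSM .c1 y z p q r ≤ 2 * S6joinM .c1 y z p q r := by decide +kernel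
/-- Certificate, first entry petal 2. [this work] -/
theorem certM_c2 : ∀ y z p q r : M3, RHSM .c2 y z p q r ≤ 2 * S6joinM .c2 y z p q r := by decide +kernel
/-- Certificate, first entry petal 3. [this work] -/
theorem certM_c3 : ∀ y z p q r : M3, RHSM .c3 y z p q r ≤ 2 * S6joinM .c3 y z p q r := by decide +kernel
/-- Certificate, first entry `⊤`. [this work] -/
theorem certM_t : ∀ y z p q r : M3, RHSM .t y z p q r ≤ 2 * S6joinM .t y z p q r := by decide +kernel

/-- **The pointwise tensor certificate** on `M3`: `RHSM ≤ 2 · S6joinM` for all six arguments. [this work] -/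
theorem certM (x y z p q r : M3) : RHSM x y z p q r ≤ 2 * S6joinM x y z p q r := by
  cases x
  · exact certM_b y z p q r
  · exact certM_c1 y z p q r
  · exact certM_c2 y z p q r
  · exact certM_c3 y z p q r
  · exact certM_t y z p q r

/-- The weights are nonnegative. [this work] -/
theorem EHM_nonneg : ∀ x y z : M3, 0 ≤ EHM x y z := by decide
/-- The weights are nonnegative. [this work] -/
theorem ER0M_nonneg : ∀ x y z : M3, 0 ≤ ER0M x y z := by decide
/-- The weights are nonnegative. [this work] -/
theorem ERpM_nonneg : ∀ i x y z : M3, 0 ≤ ERpM i x y z := by decide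
/-- The weights are nonnegative. [this work] -/
theorem ER4M_nonneg : ∀ x y z : M3, 0 ≤ ER4M x y z := by decide

/-! ## Transport to the `Fin 5` coding -/

/-- Bridge for the join. [this work] -/
theorem ofFin_joinM : ∀ x a : Fin 5, M3.ofFin (joinM x a) = joinMM (M3.ofFin x) (M3.ofFin a) := by decide

/-- Bridge for the spectator rows. [this work] -/
theorem Rrow_eq_RrowM : ∀ v x y z : Fin 5, Rrow v x y z = RrowM (M3.ofFin v) (M3.ofFin x) (M3.ofFin y) (M3.ofFin z) := by
  decide

/-- `Σ_{ρ ∈ S₃} s6H (u ∨ ρ c)` on `Fin 5`. [this work] -/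
def S6join5 (x y z a b c : Fin 5) : ℤ :=
  s6H (joinM x a) (joinM y b) (joinM z c) + s6H (joinM x a) (joinM y c) (joinM z b)
    + s6H (joinM x b) (joinM y a) (joinM z c) + s6H (joinM x b) (joinM y c) (joinM z a)
    + s6H (joinM x c) (joinM y a) (joinM z b) + s6H (joinM x c) (joinM y b) (joinM z a)

/-- Weight of the ★-row on `Fin 5` triples. [this work] -/
def EH5 (x y z : Fin 5) : ℤ := EHM (M3.ofFin x) (M3.ofFin y) (M3.ofFin z)
/-- Weight of the bottom-spectator row on `Fin 5` triples. [this work] -/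
def ER05 (x y z : Fin 5) : ℤ := ER0M (M3.ofFin x) (M3.ofFin y) (M3.ofFin z)
/-- Weight of the petal-spectator rows on `Fin 5` triples. [this work] -/
def ERp5 (i x y z : Fin 5) : ℤ := ERpM (M3.ofFin i) (M3.ofFin x) (M3.ofFin y) (M3.ofFin z)
/-- Weight of the top-spectator row on `Fin 5` triples. [this work] -/
def ER45 (x y z : Fin 5) : ℤ := ER4M (M3.ofFin x) (M3.ofFin y) (M3.ofFin z)

/-- One half of the certificate on `Fin 5`: `Σ_k E_k(x,y,z) · row_k(a,b,c)` over the rows `(s6H, R₀, R₁, R₂, R₃, R₄)`. [this work] -/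
def P5 (x y z a b c : Fin 5) : ℤ :=
  EH5 x y z * s6H a b c + ER05 x y z * Rrow 0 a b c + ERp5 1 x y z * Rrow 1 a b c
    + ERp5 2 x y z * Rrow 2 a b c + ERp5 3 x y z * Rrow 3 a b c + ER45 x y z * Rrow 4 a b c

/-- **The pointwise tensor certificate on `Fin 5`**. [this work] -/
theorem cert5 (x y z a b c : Fin 5) :
    6 * Rrow 0 x y z * Rrow 0 a b c + P5 x y z a b c + P5 a b c x y z ≤ 2 * S6join5 x y z a b c := by
  have h := certM (M3.ofFin x) (M3.ofFin y) (M3.ofFin z) (M3.ofFin a) (M3.ofFin b) (M3.ofFin c)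
  have h0 : M3.ofFin 0 = M3.b := by decide
  have h1 : M3.ofFin 1 = M3.c1 := by decide
  have h2 : M3.ofFin 2 = M3.c2 := by decide
  have h3 : M3.ofFin 3 = M3.c3 := by decide
  have h4 : M3.ofFin 4 = M3.t := by decide
  simp only [RHSM, PM, S6joinM] at h
  simp only [P5, EH5, ER05, ERp5, ER45, S6join5, s6H_eq_s6HM, Rrow_eq_RrowM, ofFin_joinM, h0, h1, h2, h3, h4]
  linarith

/-! ## Summation lemmas -/

section Sums

variable {α β : Type*} [Fintype α] [DecidableEq α] [Fintype β] [DecidableEq β]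

/-- A double sum of products with nonnegative left factors and a nonnegative right row-sum is nonnegative. [this work] -/
theorem sum_sum_mul_nonneg {ι κ : Type*} (s : Finset ι) (t : Finset κ) (f : ι → ℤ) (g : κ → ℤ)
    (hf : ∀ i ∈ s, 0 ≤ f i) (hg : 0 ≤ ∑ j ∈ t, g j) : 0 ≤ ∑ j ∈ t, ∑ i ∈ s, f i * g j := by
  rw [sum_comm, ← sum_mul_sum]
  exact mul_nonneg (sum_nonneg hf) hg

/-- The 3-cycle `k ↦ k - 1` written as a product of transpositions. [this work] -/
def cyc120 : Equiv.Perm (Fin 3) := Equiv.swap 1 2 * Equiv.swap 0 1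
/-- The 3-cycle `k ↦ k + 1` written as a product of transpositions. [this work] -/
def cyc201 : Equiv.Perm (Fin 3) := Equiv.swap 0 1 * Equiv.swap 1 2
/-- The swap `1 ↔ 2` of `Fin 3`. [this work] -/
def sw12 : Equiv.Perm (Fin 3) := Equiv.swap 1 2

/-- Block relabelling on the `G` side of the join identity. [this work] -/
theorem Sunflower.sum_zOff_perm (F : Sunflower α) (G : Sunflower β) (σ : Equiv.Perm (Fin 3)) :
    ∑ g₂ : β → Fin 3, F.zOff (G.lab (fib g₂ 0)) (G.lab (fib g₂ 1)) (G.lab (fib g₂ 2))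
      = ∑ g₂ : β → Fin 3, F.zOff (G.lab (fib g₂ (σ.symm 0))) (G.lab (fib g₂ (σ.symm 1))) (G.lab (fib g₂ (σ.symm 2))) :=
  sum_fib_perm σ (fun X Y Z => F.zOff (G.lab X) (G.lab Y) (G.lab Z))

/-- **Six times the join functional** is the double sum of the `S₃`-symmetrised join kernel. [this work] -/
theorem Sunflower.six_mul_ZH_join (F : Sunflower α) (G : Sunflower β) :
    6 * (F.join G).ZH = ∑ g₂ : β → Fin 3, ∑ g₁ : α → Fin 3,
      S6join5 (F.lab (fib g₁ 0)) (F.lab (fib g₁ 1)) (F.lab (fib g₁ 2)) (G.lab (fib g₂ 0)) (G.lab (fib g₂ 1)) (G.lab (fib g₂ 2)) := by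
  have e1 := F.sum_zOff_perm G sw12
  have e2 := F.sum_zOff_perm G sw01
  have e3 := F.sum_zOff_perm G cyc120
  have e4 := F.sum_zOff_perm G cyc201
  have e5 := F.sum_zOff_perm G sw02
  have a0 : sw12.symm 0 = 0 := by decide
  have a1 : sw12.symm 1 = 2 := by decide
  have a2 : sw12.symm 2 = 1 := by decide
  have b0 : sw01.symm 0 = 1 := by decide
  have b1 : sw01.symm 1 = 0 := by decide
  have b2 : sw01.symm 2 = 2 := by decide
  have c0 : cyc120.symm 0 = 1 := by decide
  have c1 : cyc120.symm 1 = 2 := by decide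
  have c2 : cyc120.symm 2 = 0 := by decide
  have d0 : cyc201.symm 0 = 2 := by decide
  have d1 : cyc201.symm 1 = 0 := by decide
  have d2 : cyc201.symm 2 = 1 := by decide
  have f0 : sw02.symm 0 = 2 := by decide
  have f1 : sw02.symm 1 = 1 := by decide
  have f2 : sw02.symm 2 = 0 := by decide
  rw [a0, a1, a2] at e1
  rw [b0, b1, b2] at e2
  rw [c0, c1, c2] at e3
  rw [d0, d1, d2] at e4
  rw [f0, f1, f2] at e5
  have h6 : 6 * (F.join G).ZH
      = (∑ g₂ : β → Fin 3, F.zOff (G.lab (fib g₂ 0)) (G.lab (fib g₂ 1)) (G.lab (fib g₂ 2)))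
        + (∑ g₂ : β → Fin 3, F.zOff (G.lab (fib g₂ 0)) (G.lab (fib g₂ 2)) (G.lab (fib g₂ 1)))
        + (∑ g₂ : β → Fin 3, F.zOff (G.lab (fib g₂ 1)) (G.lab (fib g₂ 0)) (G.lab (fib g₂ 2)))
        + (∑ g₂ : β → Fin 3, F.zOff (G.lab (fib g₂ 1)) (G.lab (fib g₂ 2)) (G.lab (fib g₂ 0)))
        + (∑ g₂ : β → Fin 3, F.zOff (G.lab (fib g₂ 2)) (G.lab (fib g₂ 0)) (G.lab (fib g₂ 1)))
        + (∑ g₂ : β → Fin 3, F.zOff (G.lab (fib g₂ 2)) (G.lab (fib g₂ 1)) (G.lab (fib g₂ 0))) := by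
    rw [← e1, ← e2, ← e3, ← e4, ← e5, F.ZH_join_eq G]; ring
  rw [h6]
  simp only [← sum_add_distrib]
  refine sum_congr rfl fun g₂ _ => ?_
  unfold Sunflower.zOff
  simp only [← sum_add_distrib]
  refine sum_congr rfl fun g₁ _ => ?_
  unfold S6join5
  ring

/-- A double sum of products with nonnegative right factors and a nonnegative left row-sum is nonnegative. [this work] -/
theorem sum_sum_mul_nonneg' {ι κ : Type*} (s : Finset ι) (t : Finset κ) (f : ι → ℤ) (g : κ → ℤ)
    (hg : ∀ j ∈ t, 0 ≤ g j) (hf : 0 ≤ ∑ i ∈ s, f i) : 0 ≤ ∑ j ∈ t, ∑ i ∈ s, g j * f i := by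
  refine sum_nonneg fun j hj => ?_
  rw [← mul_sum]
  exact mul_nonneg (hg j hj) hf

/-- The `P5` double sum is nonnegative (`E ≥ 0` pointwise on the `F` side; ★ and spectator Gladkov for `G`). [this work] -/
theorem Sunflower.sum_sum_P5_nonneg (F : Sunflower α) (G : Sunflower β) (hG : 0 ≤ G.ZH) :
    0 ≤ ∑ g₂ : β → Fin 3, ∑ g₁ : α → Fin 3,
      P5 (F.lab (fib g₁ 0)) (F.lab (fib g₁ 1)) (F.lab (fib g₁ 2)) (G.lab (fib g₂ 0)) (G.lab (fib g₂ 1)) (G.lab (fib g₂ 2)) := by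
  have hZ : 0 ≤ ∑ g : β → Fin 3, s6H (G.lab (fib g 0)) (G.lab (fib g 1)) (G.lab (fib g 2)) := by
    rw [← G.ZH_eq_sum_fib]; exact hG
  unfold P5
  simp only [sum_add_distrib]
  refine add_nonneg (add_nonneg (add_nonneg (add_nonneg (add_nonneg ?_ ?_) ?_) ?_) ?_) ?_
  · exact sum_sum_mul_nonneg univ univ _ _ (fun g₁ _ => EHM_nonneg _ _ _) hZ
  · exact sum_sum_mul_nonneg univ univ _ _ (fun g₁ _ => ER0M_nonneg _ _ _) (G.sum_Rrow_nonneg 0)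
  · exact sum_sum_mul_nonneg univ univ _ _ (fun g₁ _ => ERpM_nonneg _ _ _ _) (G.sum_Rrow_nonneg 1)
  · exact sum_sum_mul_nonneg univ univ _ _ (fun g₁ _ => ERpM_nonneg _ _ _ _) (G.sum_Rrow_nonneg 2)
  · exact sum_sum_mul_nonneg univ univ _ _ (fun g₁ _ => ERpM_nonneg _ _ _ _) (G.sum_Rrow_nonneg 3)
  · exact sum_sum_mul_nonneg univ univ _ _ (fun g₁ _ => ER4M_nonneg _ _ _) (G.sum_Rrow_nonneg 4)

/-- The transposed `P5` double sum is nonnegative (`E ≥ 0` pointwise on the `G` side; ★ and spectator Gladkov for `F`). [this work] -/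
theorem Sunflower.sum_sum_P5_nonneg' (F : Sunflower α) (G : Sunflower β) (hF : 0 ≤ F.ZH) :
    0 ≤ ∑ g₂ : β → Fin 3, ∑ g₁ : α → Fin 3,
      P5 (G.lab (fib g₂ 0)) (G.lab (fib g₂ 1)) (G.lab (fib g₂ 2)) (F.lab (fib g₁ 0)) (F.lab (fib g₁ 1)) (F.lab (fib g₁ 2)) := by
  have hZ : 0 ≤ ∑ g : α → Fin 3, s6H (F.lab (fib g 0)) (F.lab (fib g 1)) (F.lab (fib g 2)) := by
    rw [← F.ZH_eq_sum_fib]; exact hF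
  unfold P5
  simp only [sum_add_distrib]
  refine add_nonneg (add_nonneg (add_nonneg (add_nonneg (add_nonneg ?_ ?_) ?_) ?_) ?_) ?_
  · exact sum_sum_mul_nonneg' univ univ _ _ (fun g₂ _ => EHM_nonneg _ _ _) hZ
  · exact sum_sum_mul_nonneg' univ univ _ _ (fun g₂ _ => ER0M_nonneg _ _ _) (F.sum_Rrow_nonneg 0)
  · exact sum_sum_mul_nonneg' univ univ _ _ (fun g₂ _ => ERpM_nonneg _ _ _ _) (F.sum_Rrow_nonneg 1)
  · exact sum_sum_mul_nonneg' univ univ _ _ (fun g₂ _ => ERpM_nonneg _ _ _ _) (F.sum_Rrow_nonneg 2)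
  · exact sum_sum_mul_nonneg' univ univ _ _ (fun g₂ _ => ERpM_nonneg _ _ _ _) (F.sum_Rrow_nonneg 3)
  · exact sum_sum_mul_nonneg' univ univ _ _ (fun g₂ _ => ER4M_nonneg _ _ _) (F.sum_Rrow_nonneg 4)

end Sums

/-! ## The theorem -/

section Main

variable {α β : Type*} [Fintype α] [DecidableEq α] [Fintype β] [DecidableEq β]

/-- **★ IS CLOSED UNDER DISJOINT UNION** (this work): if the partition functionals of `F` and `G` are nonnegative, so is the partition
functional of their θ-join `F.join G`.  Proof: `12·(F.join G).ZH = Σ Σ 2·S6join5 ≥ Σ Σ [6 R₀R₀ + P5 + P5ᵗ] ≥ 0`. -/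
theorem Sunflower.ZH_join_nonneg (F : Sunflower α) (G : Sunflower β) (hF : 0 ≤ F.ZH) (hG : 0 ≤ G.ZH) :
    0 ≤ (F.join G).ZH := by
  have h12 : 12 * (F.join G).ZH = ∑ g₂ : β → Fin 3, ∑ g₁ : α → Fin 3,
      2 * S6join5 (F.lab (fib g₁ 0)) (F.lab (fib g₁ 1)) (F.lab (fib g₁ 2)) (G.lab (fib g₂ 0)) (G.lab (fib g₂ 1)) (G.lab (fib g₂ 2)) := by
    have := F.six_mul_ZH_join G
    simp only [← mul_sum]
    linarith
  have hle : ∑ g₂ : β → Fin 3, ∑ g₁ : α → Fin 3,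
      (6 * Rrow 0 (F.lab (fib g₁ 0)) (F.lab (fib g₁ 1)) (F.lab (fib g₁ 2)) * Rrow 0 (G.lab (fib g₂ 0)) (G.lab (fib g₂ 1)) (G.lab (fib g₂ 2))
        + P5 (F.lab (fib g₁ 0)) (F.lab (fib g₁ 1)) (F.lab (fib g₁ 2)) (G.lab (fib g₂ 0)) (G.lab (fib g₂ 1)) (G.lab (fib g₂ 2))
        + P5 (G.lab (fib g₂ 0)) (G.lab (fib g₂ 1)) (G.lab (fib g₂ 2)) (F.lab (fib g₁ 0)) (F.lab (fib g₁ 1)) (F.lab (fib g₁ 2)))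
      ≤ ∑ g₂ : β → Fin 3, ∑ g₁ : α → Fin 3,
        2 * S6join5 (F.lab (fib g₁ 0)) (F.lab (fib g₁ 1)) (F.lab (fib g₁ 2)) (G.lab (fib g₂ 0)) (G.lab (fib g₂ 1)) (G.lab (fib g₂ 2)) :=
    sum_le_sum fun g₂ _ => sum_le_sum fun g₁ _ => cert5 _ _ _ _ _ _
  have hR : 0 ≤ ∑ g₂ : β → Fin 3, ∑ g₁ : α → Fin 3,
      6 * Rrow 0 (F.lab (fib g₁ 0)) (F.lab (fib g₁ 1)) (F.lab (fib g₁ 2)) * Rrow 0 (G.lab (fib g₂ 0)) (G.lab (fib g₂ 1)) (G.lab (fib g₂ 2)) := by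
    rw [sum_comm, ← sum_mul_sum, ← mul_sum]
    exact mul_nonneg (mul_nonneg (by norm_num) (F.sum_Rrow_nonneg 0)) (G.sum_Rrow_nonneg 0)
  have hP := F.sum_sum_P5_nonneg G hG
  have hP' := F.sum_sum_P5_nonneg' G hF
  simp only [sum_add_distrib] at hle
  linarith

end Main

end Summit.CriticalPhenomena.PercolationContinuityZ3.Theorems.SunflowerPartition
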